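/-
Copyright: the b2b-balaban T⁴-continuum CRUX team, row NE7b OWNER lineage `t4-ne7b-p1` (gen 118). Project licence.
-/
import Summits.QuantumFields.BalabanUV.T4Continuum.Spine.NE7b.SupTorusBackgroundDerivative

/-!
# WITH A CONTINUOUS CURVATURE `u′` THE BACKGROUND MAP IS `C¹` AND THE EFFECTIVE ACTION IS `C²` ON THE WHOLE COARSE CARRIER: in
# the convex regime `u′ ≥ −λ`, `λ < min(2,a)` the fibre response `w ↦ Dt(w)` of (100)∕(101) is a CONTINUOUS function of the block
# field as soon as `u′` is continuous (modulus: `(min(2,a) − λ)²·Σ (Dt(w)k − Dt(w₀)k)² ≤ sup_x |u′(Φ w x) − u′(Φ w₀ x)|²·Σ (Dt(w₀)k)²`),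
# so ANY background map `Φ` is `ContDiff ℝ 1` and the effective action `W = S ∘ Φ` is `ContDiff ℝ 2` — by the envelope structure
# `∇W = (∇S ∘ Φ)∘M` of (96), one derivative of `Φ` suffices for two of `W`
# (row NE7b, node U5c; (96) + (100) + (101) + TEA BY NAME; [folklore])

Cell `pub-balaban`, sub-cell `t4`, spine estimate NE7b (`T4WeightBudget.RelWeightBound`; the cell's OWN estimate — NOT PRINTED in
[Bałaban 1983–89], NOT PROVED).  Crux-route work under `Spine/NE7b/` by the row OWNER (`t4-ne7b-p1` gen 118) under FREEZE (0)'s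
crux-prover clause (convexity column, the regularity class of the next-scale action); NOTHING of Bałaban's is named as a Lean
object, valued or asserted; no `T4Continuum/Support` leaf typed; no `def`, no notation; zero `sorry`.  Imports (BY NAME): the
OWNER's (101) `…SupTorusBackgroundDerivative` (`torus_background_continuous` ∕ `exists_hasFDerivAt_fibreCritical` ∕
`continuousAt_fibreCritical`; through it (100) `exists_fibre_response`, (96) `hasFDerivAt_fibreMin_comp` ∕ `exists_clm_blockLift` ∕
`sq_sum_le_of_strongMonotone`, (93) `norm_sq_le_sum_sq`, (90) `response_form_floor`, (89) `torus_form_coercive`, TEA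
`exists_clm_pairForm` ∕ `differentiableAt_action`, INST `fderiv_action_torus_eq_zero`, TDF `torus_operator_form_symm`, (93)
`hasDerivAt_phiFour_potential`, (86) `hasDerivAt_phiFour`).

WHY (located).  (101)∕(102) give the derivative of `Φ` and the second derivative of `W` AT EVERY POINT with no hypothesis on `u′`
beyond existence and the floor; the regularity CLASS (`C¹`, `C²`) needs the response to vary continuously, which is exactly
continuity of `u′` along the (continuous) background: two responses at nearby fields differ by a fibre field `r` on which the
linearised form at one field is tested against the other's letter, leaving `Σ (u′(φ) − u′(φ′))·(D′k)·r`, and the floor closes.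
`W` is then `C²` although `Φ` is only `C¹`: `∇W(w) = DS(Φ w)∘M` ((96)) is a `C¹` function of `w` (`DS` is `C¹`, `Φ` is `C¹`).

WHAT IS PROVED ([folklore]):
* §1 (TEA's level) `response_sub_pairing_le` ∕ **`response_sub_sq_le`** (two fields `φ, φ′`, responses `D, D′` with the letters at
  `u′∘φ`, `u′∘φ′`: `(γ − λ)²·Σ_x (D′k x − D k x)² ≤ Σ_x ((u′(φ x) − u′(φ′ x))·(D′ k) x)²`), **`continuous_response`** (`u′`
  continuous, `Φ` continuous ⟹ ANY response family `w ↦ D(w)` with the two letters at `u′∘Φ w` is continuous in operator norm),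
  **`contDiff_one_fibreCritical`** (`Φ` is `C¹`), `contDiff_two_potential` ∕ **`contDiff_two_action`** (`S` is `C²`),
  **`contDiff_two_fibreMin`** (`W = S ∘ Φ` is `C²`).
* §2 (the `Beta.Site` carriers, displayed actions; `u′ ≥ −λ` on `ℝ`, `λ < min(2,a)`, `u′` continuous) THE ENDs
  **`torus_background_contDiff_one`** (ANY background map is `C¹`) and **`torus_effectiveAction_contDiff_two`** (the torus effective
  action is `C²` on the whole coarse carrier).
* §3 **`phiFour_effectiveAction_contDiff_two`** (`u t = g t³ + m t`, `0 ≤ g`, `−m < min(2,a)`).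
* §4 toy.

HONEST (what this is NOT).  Regularity CLASS only — no modulus of continuity for `w ↦ W″(w)` beyond what continuity of `u′` gives,
no `C³` (needs `u″`), no analyticity; constants OURS; nothing about the measure; cubic periods; scalar skeleton, hard constraint, not
the covariant operators ((A3), NC-NE7b-α UNRULED); nothing of Bałaban's.  BY-NAME EFFECT ON THE WALL: NONE.  NE7b NOT PRINTED ∕ NOT
PROVED; spine PROVED 0∕9; rung (B)+1 on a FINITE torus — NOT infinite volume, NOT the mass gap, NOT Clay.  HONEST DEPENDENCY:
continuum YM on T⁴ ⇐ BetaPertH ∧ nine spine estimates (0∕9 proved); BetaPertH ⇐ (D1) ∧ (D4) ∧ CAP+tail; G-an2-4 gates asym, D1 and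
NE2∕3∕4.
-/

set_option autoImplicit false

noncomputable section

namespace Summit.QuantumFields.BalabanUV.T4Continuum.NE7b.SupTorusEffectiveActionSmooth

open Set Function Filter Metric
open scoped ENNReal Topology ContDiff
open Literature.MathematicalPhysics.QuantumFieldTheory.Balaban1983to89
open B6QGQLower276 (X blk B side AX)
open B5Hk103ScalarZd (nbhd)
open Beta (Site siteOf windowMap)
open SupTorusDirichletForm (torus_operator_form_symm)
open SupTorusDirichletFormCoercive (torus_form_coercive)
open SupTorusEffectiveAction (exists_clm_pairForm differentiableAt_action)
open SupTorusEffectiveActionInstance (fderiv_action_torus_eq_zero)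
open SupTorusActionMinimiser (norm_sq_le_sum_sq hasDerivAt_phiFour_potential)
open SupTorusEffectiveActionHessianFloor (response_form_floor)
open SupTorusEffectiveActionGradient (hasFDerivAt_fibreMin_comp exists_clm_blockLift sq_sum_le_of_strongMonotone)
open SupTorusFibreResponse (exists_fibre_response)
open SupTorusBackgroundDerivative (continuousAt_fibreCritical exists_hasFDerivAt_fibreCritical torus_background_continuous)
open SupPhiFourBackground (hasDerivAt_phiFour)

variable {d : ℕ}

/-! ## §1. TEA's level: the response is continuous in the field, `Φ` is `C¹`, `S` and `W` are `C²` -/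

section Generic

variable {ι κ : Type*} [Fintype ι] [Fintype κ]

omit [Fintype κ] in
/-- **TWO RESPONSES DIFFER BY WHAT THE CURVATURE DIFFERENCE DOES, PAIRING FORM**: floor `γ` for `At`, `−λ ≤ u′(φ x)`; `D, D′`
sections of `Qt` whose linearised covectors at `u′∘φ`, `u′∘φ′` kill `ker Qt`.  Then for every `k`, with `r = D′k − Dk`:
`(γ − λ)·Σ_x r x² ≤ Σ_x ((u′(φ′ x) − u′(φ x))·(D′k) x)·(−r x)`… stated as `(γ − λ)·Σ r² ≤ Σ ((u′(φ x) − u′(φ′ x))·(D′k) x)·r x`.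
[folklore] -/
theorem response_sub_pairing_le (At : (ι → ℝ) →L[ℝ] (ι → ℝ)) {u' : ℝ → ℝ} {φ φ' : ι → ℝ} {γ lam : ℝ}
    (hγ : ∀ h : ι → ℝ, γ * ∑ x, h x ^ 2 ≤ ∑ x, h x * At h x) (hu'φ : ∀ x, -lam ≤ u' (φ x))
    (Qt : (ι → ℝ) →L[ℝ] (κ → ℝ)) {D D' : (κ → ℝ) →L[ℝ] (ι → ℝ)} (hDQ : ∀ k : κ → ℝ, Qt (D k) = k)
    (hDlin : ∀ (k : κ → ℝ) (κ' : ι → ℝ), Qt κ' = 0 → ∑ x, (At (D k) x + u' (φ x) * D k x) * κ' x = 0)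
    (hD'Q : ∀ k : κ → ℝ, Qt (D' k) = k)
    (hD'lin : ∀ (k : κ → ℝ) (κ' : ι → ℝ), Qt κ' = 0 → ∑ x, (At (D' k) x + u' (φ' x) * D' k x) * κ' x = 0) (k : κ → ℝ) :
    (γ - lam) * ∑ x, (D' k x - D k x) ^ 2 ≤ ∑ x, ((u' (φ x) - u' (φ' x)) * D' k x) * (D' k x - D k x) := by
  have hQr : Qt (D' k - D k) = 0 := by rw [map_sub, hD'Q, hDQ, sub_self]
  have hfl := response_form_floor At hγ hu'φ (D' k - D k)
  have hlin : ∀ x, At (D' k - D k) x = At (D' k) x - At (D k) x := fun x => by rw [map_sub]; rfl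
  have h1 := hDlin k (D' k - D k) hQr
  have h2 := hD'lin k (D' k - D k) hQr
  have hsplit : ∑ x, (At (D' k - D k) x + u' (φ x) * (D' k - D k) x) * (D' k - D k) x
      = ∑ x, (At (D' k) x + u' (φ' x) * D' k x) * (D' k - D k) x
        - ∑ x, (At (D k) x + u' (φ x) * D k x) * (D' k - D k) x
        + ∑ x, ((u' (φ x) - u' (φ' x)) * D' k x) * (D' k x - D k x) := by
    rw [← Finset.sum_sub_distrib, ← Finset.sum_add_distrib]
    exact Finset.sum_congr rfl fun x _ => by simp only [hlin, Pi.sub_apply]; ring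
  rw [hsplit, h1, h2, sub_zero, zero_add] at hfl
  simpa only [Pi.sub_apply] using hfl

omit [Fintype κ] in
/-- **TWO RESPONSES DIFFER BY WHAT THE CURVATURE DIFFERENCE DOES, `ℓ²` FORM** (`λ ≤ γ`):
`(γ − λ)²·Σ_x (D′k x − Dk x)² ≤ Σ_x ((u′(φ x) − u′(φ′ x))·(D′k) x)²`. [folklore] -/
theorem response_sub_sq_le (At : (ι → ℝ) →L[ℝ] (ι → ℝ)) {u' : ℝ → ℝ} {φ φ' : ι → ℝ} {γ lam : ℝ}
    (hγ : ∀ h : ι → ℝ, γ * ∑ x, h x ^ 2 ≤ ∑ x, h x * At h x) (hu'φ : ∀ x, -lam ≤ u' (φ x)) (hγlam : lam ≤ γ)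
    (Qt : (ι → ℝ) →L[ℝ] (κ → ℝ)) {D D' : (κ → ℝ) →L[ℝ] (ι → ℝ)} (hDQ : ∀ k : κ → ℝ, Qt (D k) = k)
    (hDlin : ∀ (k : κ → ℝ) (κ' : ι → ℝ), Qt κ' = 0 → ∑ x, (At (D k) x + u' (φ x) * D k x) * κ' x = 0)
    (hD'Q : ∀ k : κ → ℝ, Qt (D' k) = k)
    (hD'lin : ∀ (k : κ → ℝ) (κ' : ι → ℝ), Qt κ' = 0 → ∑ x, (At (D' k) x + u' (φ' x) * D' k x) * κ' x = 0) (k : κ → ℝ) :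
    (γ - lam) ^ 2 * ∑ x, (D' k x - D k x) ^ 2 ≤ ∑ x, ((u' (φ x) - u' (φ' x)) * D' k x) ^ 2 :=
  sq_sum_le_of_strongMonotone (sub_nonneg.2 hγlam) (fun x => D' k x - D k x) (fun x => (u' (φ x) - u' (φ' x)) * D' k x)
    (response_sub_pairing_le At hγ hu'φ Qt hDQ hDlin hD'Q hD'lin k)

omit [Fintype κ] in
/-- On a finite carrier, `Σ_x (g x)² ≤ |ι|·‖g‖²` (sup norm). [folklore] -/
theorem sum_sq_le_card_mul_norm_sq (g : ι → ℝ) : ∑ x, g x ^ 2 ≤ (Fintype.card ι : ℝ) * ‖g‖ ^ 2 := by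
  have h : ∀ x ∈ (Finset.univ : Finset ι), g x ^ 2 ≤ ‖g‖ ^ 2 := fun x _ => by
    have hx : |g x| ≤ ‖g‖ := by simpa only [Real.norm_eq_abs] using norm_le_pi_norm g x
    calc g x ^ 2 = |g x| ^ 2 := (sq_abs _).symm
      _ ≤ ‖g‖ ^ 2 := pow_le_pow_left₀ (abs_nonneg _) hx 2
  calc ∑ x, g x ^ 2 ≤ ∑ _x : ι, ‖g‖ ^ 2 := Finset.sum_le_sum h
    _ = (Fintype.card ι : ℝ) * ‖g‖ ^ 2 := by rw [Finset.sum_const, Finset.card_univ, nsmul_eq_mul]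

/-- **THE RESPONSE IS CONTINUOUS IN THE BLOCK FIELD WHEN `u′` IS CONTINUOUS**: floor `γ` for `At`, `u′ ≥ −λ` on `ℝ`, `λ < γ`, `u′`
continuous; `Φ` continuous; `D(w)` ANY response family (`Qt (D w k) = k`, the linearised covector at `u′∘Φ w` on `D w k` kills
`ker Qt`, at every `w`).  Then `w ↦ D w` is continuous into the operator-norm topology. [folklore] -/
theorem continuous_response (At : (ι → ℝ) →L[ℝ] (ι → ℝ)) {γ : ℝ}
    (hγ : ∀ h : ι → ℝ, γ * ∑ x, h x ^ 2 ≤ ∑ x, h x * At h x) {u' : ℝ → ℝ} (hu'c : Continuous u') {lam : ℝ}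
    (hu' : ∀ t, -lam ≤ u' t) (hγlam : lam < γ) (Qt : (ι → ℝ) →L[ℝ] (κ → ℝ)) {Φ : (κ → ℝ) → (ι → ℝ)} (hΦc : Continuous Φ)
    {D : (κ → ℝ) → (κ → ℝ) →L[ℝ] (ι → ℝ)} (hDQ : ∀ (w k : κ → ℝ), Qt (D w k) = k)
    (hDlin : ∀ (w k : κ → ℝ) (κ' : ι → ℝ), Qt κ' = 0 → ∑ x, (At (D w k) x + u' (Φ w x) * D w k x) * κ' x = 0) :
    Continuous D := by
  have hm : 0 < γ - lam := sub_pos.2 hγlam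
  -- the curvature along the background, as a continuous map into the sup-normed carrier
  have hG : Continuous (fun w : κ → ℝ => fun x : ι => u' (Φ w x)) :=
    continuous_pi fun x => hu'c.comp ((continuous_apply x).comp hΦc)
  refine continuous_iff_continuousAt.2 fun w₀ => Metric.continuousAt_iff.2 fun ε hε => ?_
  -- tolerance on the curvature
  set C : ℝ := Real.sqrt (Fintype.card ι : ℝ) * ‖D w₀‖ with hC
  have hC0 : 0 ≤ C := mul_nonneg (Real.sqrt_nonneg _) (norm_nonneg _)
  set η : ℝ := ε * (γ - lam) / (2 * (C + 1)) with hη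
  have hη0 : 0 < η := by positivity
  obtain ⟨δ, hδ0, hδ⟩ := Metric.continuousAt_iff.1 (hG.continuousAt (x := w₀)) η hη0
  refine ⟨δ, hδ0, fun w hw => ?_⟩
  have hux : ∀ x, |u' (Φ w x) - u' (Φ w₀ x)| ≤ η := fun x => by
    have h1 := hδ hw
    rw [dist_eq_norm] at h1
    have h2 := norm_le_pi_norm ((fun x : ι => u' (Φ w x)) - fun x : ι => u' (Φ w₀ x)) x
    rw [Pi.sub_apply, Real.norm_eq_abs] at h2
    exact h2.trans h1.le
  -- the operator-norm bound
  rw [dist_eq_norm]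
  have hbound : ∀ k : κ → ℝ, ‖(D w - D w₀) k‖ ≤ η / (γ - lam) * C * ‖k‖ := by
    intro k
    -- `(γ − λ)²·Σ r² ≤ Σ ((u′(Φ w x) − u′(Φ w₀ x))·(D w₀ k) x)² ≤ η²·|ι|·‖D w₀‖²·‖k‖²`
    have h1 := response_sub_sq_le At hγ (fun x => hu' (Φ w x)) hγlam.le Qt (hDQ w) (hDlin w) (hDQ w₀) (hDlin w₀) k
    have h2 : ∑ x, ((u' (Φ w x) - u' (Φ w₀ x)) * D w₀ k x) ^ 2 ≤ η ^ 2 * ((Fintype.card ι : ℝ) * ‖D w₀ k‖ ^ 2) := by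
      calc ∑ x, ((u' (Φ w x) - u' (Φ w₀ x)) * D w₀ k x) ^ 2
          = ∑ x, (u' (Φ w x) - u' (Φ w₀ x)) ^ 2 * D w₀ k x ^ 2 := Finset.sum_congr rfl fun x _ => by ring
        _ ≤ ∑ x, η ^ 2 * D w₀ k x ^ 2 := Finset.sum_le_sum fun x _ =>
            mul_le_mul_of_nonneg_right (by
              rw [← sq_abs]; exact pow_le_pow_left₀ (abs_nonneg _) (hux x) 2) (sq_nonneg _)
        _ = η ^ 2 * ∑ x, D w₀ k x ^ 2 := by rw [Finset.mul_sum]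
        _ ≤ η ^ 2 * ((Fintype.card ι : ℝ) * ‖D w₀ k‖ ^ 2) :=
            mul_le_mul_of_nonneg_left (sum_sq_le_card_mul_norm_sq (D w₀ k)) (sq_nonneg _)
    have h3 : ‖D w₀ k‖ ≤ ‖D w₀‖ * ‖k‖ := (D w₀).le_opNorm k
    have h4 : ‖(D w - D w₀) k‖ ^ 2 ≤ ∑ x, (D w₀ k x - D w k x) ^ 2 := by
      have := norm_sq_le_sum_sq (D w₀ k - D w k)
      rw [← norm_neg]
      have hneg : -((D w - D w₀) k) = D w₀ k - D w k := by rw [sub_apply]; abel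
      rw [hneg]
      simpa only [Pi.sub_apply] using this
    -- assemble: `((γ−λ)‖r‖)² ≤ (η·√|ι|·‖D w₀‖·‖k‖)²`
    have h5 : ((γ - lam) * ‖(D w - D w₀) k‖) ^ 2 ≤ (η * C * ‖k‖) ^ 2 := by
      have hsq : (Real.sqrt (Fintype.card ι : ℝ)) ^ 2 = (Fintype.card ι : ℝ) := Real.sq_sqrt (Nat.cast_nonneg _)
      calc ((γ - lam) * ‖(D w - D w₀) k‖) ^ 2 = (γ - lam) ^ 2 * ‖(D w - D w₀) k‖ ^ 2 := by ring
        _ ≤ (γ - lam) ^ 2 * ∑ x, (D w₀ k x - D w k x) ^ 2 := mul_le_mul_of_nonneg_left h4 (sq_nonneg _)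
        _ ≤ ∑ x, ((u' (Φ w x) - u' (Φ w₀ x)) * D w₀ k x) ^ 2 := h1
        _ ≤ η ^ 2 * ((Fintype.card ι : ℝ) * ‖D w₀ k‖ ^ 2) := h2
        _ ≤ η ^ 2 * ((Fintype.card ι : ℝ) * (‖D w₀‖ * ‖k‖) ^ 2) :=
            mul_le_mul_of_nonneg_left (mul_le_mul_of_nonneg_left
              (pow_le_pow_left₀ (norm_nonneg _) h3 2) (Nat.cast_nonneg _)) (sq_nonneg _)
        _ = (η * C * ‖k‖) ^ 2 := by rw [hC]; ring_nf; rw [hsq]; ring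
    have h6 : (γ - lam) * ‖(D w - D w₀) k‖ ≤ η * C * ‖k‖ :=
      (sq_le_sq₀ (by positivity) (by positivity)).1 h5
    rw [div_mul_eq_mul_div, div_mul_eq_mul_div, le_div_iff₀ hm]
    calc ‖(D w - D w₀) k‖ * (γ - lam) = (γ - lam) * ‖(D w - D w₀) k‖ := mul_comm _ _
      _ ≤ η * C * ‖k‖ := h6
  have hop : ‖D w - D w₀‖ ≤ η / (γ - lam) * C :=
    ContinuousLinearMap.opNorm_le_bound _ (by positivity) hbound
  calc ‖D w - D w₀‖ ≤ η / (γ - lam) * C := hop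
    _ = ε / 2 * (C / (C + 1)) := by rw [hη]; field_simp
    _ ≤ ε / 2 * 1 := mul_le_mul_of_nonneg_left ((div_le_one (by positivity)).2 (by linarith)) (by positivity)
    _ < ε := by linarith

/-- **A MAP WITH A CONTINUOUS DERIVATIVE FAMILY IS `C¹`**: `HasFDerivAt Φ (D w) w` at every `w` and `w ↦ D w` continuous ⟹
`ContDiff ℝ 1 Φ`. [folklore] -/
theorem contDiff_one_of_hasFDerivAt {E F : Type*} [NormedAddCommGroup E] [NormedSpace ℝ E] [NormedAddCommGroup F]
    [NormedSpace ℝ F] {Φ : E → F} {D : E → E →L[ℝ] F} (hD : ∀ w, HasFDerivAt Φ (D w) w) (hDc : Continuous D) :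
    ContDiff ℝ 1 Φ := by
  have hf : fderiv ℝ Φ = D := funext fun w => (hD w).fderiv
  exact contDiff_one_iff_fderiv.2 ⟨fun w => (hD w).differentiableAt, by rw [hf]; exact hDc⟩

/-- **THE FIBRE-CRITICAL MAP IS `C¹` WHEN `u′` IS CONTINUOUS** (symmetric `At` with floor `γ`, `v′ = u`, `u′` a continuous
derivative of `u`, `u′ ≥ −λ`, `λ < γ`; `Qt` with a right inverse `M`; `Φ` ANY map with `Qt(Φ w) = w` and fibre-critical values).
[folklore] -/
theorem contDiff_one_fibreCritical (At : (ι → ℝ) →L[ℝ] (ι → ℝ))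
    (hAt : ∀ φ ψ : ι → ℝ, ∑ x, ψ x * At φ x = ∑ x, φ x * At ψ x) {γ : ℝ}
    (hγ : ∀ h : ι → ℝ, γ * ∑ x, h x ^ 2 ≤ ∑ x, h x * At h x) {v u u' : ℝ → ℝ} (hv : ∀ t, HasDerivAt v (u t) t)
    (hu : ∀ t, HasDerivAt u (u' t) t) (hu'c : Continuous u') {lam : ℝ} (hu' : ∀ t, -lam ≤ u' t) (hγlam : lam < γ)
    (Qt : (ι → ℝ) →L[ℝ] (κ → ℝ)) (M : (κ → ℝ) →L[ℝ] (ι → ℝ)) (hM : ∀ k : κ → ℝ, Qt (M k) = k)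
    (Φ : (κ → ℝ) → (ι → ℝ)) (hΦQ : ∀ w, Qt (Φ w) = w)
    (hΦcrit : ∀ (w : κ → ℝ) (h : ι → ℝ), Qt h = 0 →
      fderiv ℝ (fun φ : ι → ℝ => (1 / 2 : ℝ) * ∑ x, φ x * At φ x + ∑ x, v (φ x)) (Φ w) h = 0) :
    ContDiff ℝ 1 Φ := by
  choose D hD using fun w : κ → ℝ =>
    exists_hasFDerivAt_fibreCritical At hAt hγ hv hu hu' hγlam Qt M hM Φ hΦQ hΦcrit w
  have hΦc : Continuous Φ := continuous_iff_continuousAt.2 fun w =>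
    continuousAt_fibreCritical At hAt hγ hv hu hu' hγlam Qt M hM Φ hΦQ hΦcrit w
  exact contDiff_one_of_hasFDerivAt (fun w => (hD w).2.2)
    (continuous_response At hγ hu'c hu' hγlam Qt hΦc (fun w => (hD w).1) (fun w => (hD w).2.1))

omit [Fintype κ] in
/-- **A POTENTIAL WITH A CONTINUOUS SECOND DERIVATIVE IS `C²`**: `v′ = u`, `u′` a continuous derivative of `u` ⟹ `ContDiff ℝ 2 v`.
[folklore] -/
theorem contDiff_two_potential {v u u' : ℝ → ℝ} (hv : ∀ t, HasDerivAt v (u t) t) (hu : ∀ t, HasDerivAt u (u' t) t)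
    (hu'c : Continuous u') : ContDiff ℝ 2 v := by
  have hv1 : deriv v = u := funext fun t => (hv t).deriv
  have hu1 : deriv u = u' := funext fun t => (hu t).deriv
  have huC : ContDiff ℝ 1 u := contDiff_one_iff_deriv.2 ⟨fun t => (hu t).differentiableAt, by rw [hu1]; exact hu'c⟩
  rw [show (2 : ℕ∞ω) = 1 + 1 from rfl]
  exact contDiff_succ_iff_deriv.2 ⟨fun t => (hv t).differentiableAt, fun h => absurd h (by simp), by rw [hv1]; exact huC⟩

omit [Fintype κ] in
/-- **THE ACTION IS `C²` WHEN `u′` IS CONTINUOUS**: `φ ↦ ½Σ φ·At φ + Σ v(φ x)` is `ContDiff ℝ 2`. [folklore] -/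
theorem contDiff_two_action (At : (ι → ℝ) →L[ℝ] (ι → ℝ)) {v u u' : ℝ → ℝ} (hv : ∀ t, HasDerivAt v (u t) t)
    (hu : ∀ t, HasDerivAt u (u' t) t) (hu'c : Continuous u') :
    ContDiff ℝ 2 (fun φ : ι → ℝ => (1 / 2 : ℝ) * ∑ x, φ x * At φ x + ∑ x, v (φ x)) := by
  have hvC := contDiff_two_potential hv hu hu'c
  have hquad : ContDiff ℝ 2 (fun φ : ι → ℝ => ∑ x, φ x * At φ x) :=
    ContDiff.sum fun x _ => (contDiff_apply ℝ ℝ x).mul ((contDiff_apply ℝ ℝ x).comp At.contDiff)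
  have hpot : ContDiff ℝ 2 (fun φ : ι → ℝ => ∑ x, v (φ x)) :=
    ContDiff.sum fun x _ => hvC.comp (contDiff_apply ℝ ℝ x)
  exact (contDiff_const.mul hquad).add hpot

/-- **THE FIBRE MINIMUM IS `C²` WHEN `u′` IS CONTINUOUS** (the envelope structure: `∇W = (∇S ∘ Φ)∘M` with `S ∈ C²`, `Φ ∈ C¹`): under
the letters of `contDiff_one_fibreCritical`, `w ↦ S(Φ w)` is `ContDiff ℝ 2`. [folklore] -/
theorem contDiff_two_fibreMin (At : (ι → ℝ) →L[ℝ] (ι → ℝ))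
    (hAt : ∀ φ ψ : ι → ℝ, ∑ x, ψ x * At φ x = ∑ x, φ x * At ψ x) {γ : ℝ}
    (hγ : ∀ h : ι → ℝ, γ * ∑ x, h x ^ 2 ≤ ∑ x, h x * At h x) {v u u' : ℝ → ℝ} (hv : ∀ t, HasDerivAt v (u t) t)
    (hu : ∀ t, HasDerivAt u (u' t) t) (hu'c : Continuous u') {lam : ℝ} (hu' : ∀ t, -lam ≤ u' t) (hγlam : lam < γ)
    (Qt : (ι → ℝ) →L[ℝ] (κ → ℝ)) (M : (κ → ℝ) →L[ℝ] (ι → ℝ)) (hM : ∀ k : κ → ℝ, Qt (M k) = k)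
    (Φ : (κ → ℝ) → (ι → ℝ)) (hΦQ : ∀ w, Qt (Φ w) = w)
    (hΦcrit : ∀ (w : κ → ℝ) (h : ι → ℝ), Qt h = 0 →
      fderiv ℝ (fun φ : ι → ℝ => (1 / 2 : ℝ) * ∑ x, φ x * At φ x + ∑ x, v (φ x)) (Φ w) h = 0) :
    ContDiff ℝ 2 (fun w : κ → ℝ => (1 / 2 : ℝ) * ∑ x, Φ w x * At (Φ w) x + ∑ x, v (Φ w x)) := by
  have hΦ1 := contDiff_one_fibreCritical At hAt hγ hv hu hu'c hu' hγlam Qt M hM Φ hΦQ hΦcrit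
  have hS2 := contDiff_two_action At hv hu hu'c (ι := ι)
  -- the gradient of `W` as a function of `w`
  have hW : ∀ w : κ → ℝ, HasFDerivAt (fun w' : κ → ℝ => (1 / 2 : ℝ) * ∑ x, Φ w' x * At (Φ w') x + ∑ x, v (Φ w' x))
      ((fderiv ℝ (fun φ : ι → ℝ => (1 / 2 : ℝ) * ∑ x, φ x * At φ x + ∑ x, v (φ x)) (Φ w)).comp M) w := fun w =>
    hasFDerivAt_fibreMin_comp At hAt hγ hv hu hu' hγlam.le Qt M hM Φ hΦQ hΦcrit w
  have hfW : fderiv ℝ (fun w' : κ → ℝ => (1 / 2 : ℝ) * ∑ x, Φ w' x * At (Φ w') x + ∑ x, v (Φ w' x))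
      = fun w => ((ContinuousLinearMap.compL ℝ (κ → ℝ) (ι → ℝ) ℝ).flip M)
          (fderiv ℝ (fun φ : ι → ℝ => (1 / 2 : ℝ) * ∑ x, φ x * At φ x + ∑ x, v (φ x)) (Φ w)) := by
    funext w
    rw [(hW w).fderiv]
    rfl
  -- `fderiv S` is `C¹`, `Φ` is `C¹`, precomposition with `M` is linear
  have hDS1 : ContDiff ℝ 1 (fderiv ℝ (fun φ : ι → ℝ => (1 / 2 : ℝ) * ∑ x, φ x * At φ x + ∑ x, v (φ x))) :=
    hS2.fderiv_right (by norm_cast)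
  have hgrad : ContDiff ℝ 1 (fderiv ℝ (fun w' : κ → ℝ => (1 / 2 : ℝ) * ∑ x, Φ w' x * At (Φ w') x + ∑ x, v (Φ w' x))) := by
    rw [hfW]
    exact ((ContinuousLinearMap.compL ℝ (κ → ℝ) (ι → ℝ) ℝ).flip M).contDiff.comp (hDS1.comp hΦ1)
  rw [show (2 : ℕ∞ω) = 1 + 1 from rfl]
  exact contDiff_succ_iff_fderiv.2 ⟨fun w => (hW w).differentiableAt, fun h => absurd h (by simp), hgrad⟩

end Generic

/-! ## §2. The torus: the background map is `C¹`, the effective action is `C²` -/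

section Torus

variable (n : ℕ) (a : ℝ) (s : ℕ) [NeZero s]
  {Dop Aop : lp (fun _ : X d => ℝ) ∞ →L[ℝ] lp (fun _ : X d => ℝ) ∞}
  (hD : ∀ (f : lp (fun _ : X d => ℝ) ∞) (y : X d), Dop f y = (((n : ℝ) + 1) ^ d)⁻¹ * ∑ p ∈ B n y, f p)
  (hA : ∀ (f : lp (fun _ : X d => ℝ) ∞) (p : X d), Aop f p = ∑ r ∈ nbhd n p, AX n a p r * f r)
  {v u u' : ℝ → ℝ} (hv : ∀ t, HasDerivAt v (u t) t) (hu : ∀ t, HasDerivAt u (u' t) t) (hu'c : Continuous u')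
  {lam : ℝ} (hu' : ∀ t, -lam ≤ u' t) (hγ : lam < min 2 a)
  {Ef : (Site d ((n + 1) * s) → ℝ) →L[ℝ] lp (fun _ : X d => ℝ) ∞}
  (hEf : ∀ (g : Site d ((n + 1) * s) → ℝ) (q : X d), Ef g q = g (siteOf d ((n + 1) * s) q))
  {Rf : lp (fun _ : X d => ℝ) ∞ →L[ℝ] (Site d ((n + 1) * s) → ℝ)}
  (hRf : ∀ (h : lp (fun _ : X d => ℝ) ∞) (x : Site d ((n + 1) * s)), Rf h x = h (windowMap d ((n + 1) * s) x))
  {Rc : lp (fun _ : X d => ℝ) ∞ →L[ℝ] (Site d s → ℝ)}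
  (hRc : ∀ (h : lp (fun _ : X d => ℝ) ∞) (x : Site d s), Rc h x = h (windowMap d s x))

include hD hA hv hu hu'c hu' hγ hEf hRf hRc in
/-- **THE END: ANY TORUS BACKGROUND MAP IS `C¹` WHEN `u′` IS CONTINUOUS.**  `v′ = u`, `u′` a continuous derivative of `u` with
`u′ ≥ −λ` on `ℝ`, `λ < min(2,a)`; `Φ` ANY background map (block means + the sitewise equation at every `w` — exists uniquely by
(93)).  Then `ContDiff ℝ 1 Φ` — every mesh, period, dimension. [folklore] -/
theorem torus_background_contDiff_one (Φ : (Site d s → ℝ) → (Site d ((n + 1) * s) → ℝ))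
    (hΦQ : ∀ w : Site d s → ℝ, ((Rc.comp Dop).comp Ef) (Φ w) = w)
    (hΦeq : ∀ (w : Site d s → ℝ) (p : X d), Aop (Ef (Φ w)) p + u (Ef (Φ w) p)
      = (((n : ℝ) + 1) ^ d)⁻¹ * ∑ p' ∈ B n (blk n p), (Aop (Ef (Φ w)) p' + u (Ef (Φ w) p'))) :
    ContDiff ℝ 1 Φ := by
  obtain ⟨M, -, hM⟩ := exists_clm_blockLift n s hD hEf hRc
  exact contDiff_one_fibreCritical ((Rf.comp Aop).comp Ef) (torus_operator_form_symm n a s hA hEf hRf)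
    (torus_form_coercive n a s hA hEf hRf) hv hu hu'c hu' hγ ((Rc.comp Dop).comp Ef) M hM Φ hΦQ
    (fun w h hh => fderiv_action_torus_eq_zero n a s hD hA hEf hRf hRc hv (Φ w) (hΦeq w) h hh)

include hD hA hv hu hu'c hu' hγ hEf hRf hRc in
/-- **THE END: THE TORUS EFFECTIVE ACTION IS `C²` ON THE WHOLE COARSE CARRIER WHEN `u′` IS CONTINUOUS.**  Same letters; `Φ` ANY
background map.  Then `w ↦ ½Σ (Φ w)·At(Φ w) + Σ v(Φ w x)` is `ContDiff ℝ 2` — with (102) its Hessian has the floor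
`(min(2,a) − λ)(n+1)^d` everywhere. [folklore] -/
theorem torus_effectiveAction_contDiff_two (Φ : (Site d s → ℝ) → (Site d ((n + 1) * s) → ℝ))
    (hΦQ : ∀ w : Site d s → ℝ, ((Rc.comp Dop).comp Ef) (Φ w) = w)
    (hΦeq : ∀ (w : Site d s → ℝ) (p : X d), Aop (Ef (Φ w)) p + u (Ef (Φ w) p)
      = (((n : ℝ) + 1) ^ d)⁻¹ * ∑ p' ∈ B n (blk n p), (Aop (Ef (Φ w)) p' + u (Ef (Φ w) p'))) :
    ContDiff ℝ 2 (fun w : Site d s → ℝ =>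
      (1 / 2 : ℝ) * ∑ x, Φ w x * ((Rf.comp Aop).comp Ef) (Φ w) x + ∑ x, v (Φ w x)) := by
  obtain ⟨M, -, hM⟩ := exists_clm_blockLift n s hD hEf hRc
  exact contDiff_two_fibreMin ((Rf.comp Aop).comp Ef) (torus_operator_form_symm n a s hA hEf hRf)
    (torus_form_coercive n a s hA hEf hRf) hv hu hu'c hu' hγ ((Rc.comp Dop).comp Ef) M hM Φ hΦQ
    (fun w h hh => fderiv_action_torus_eq_zero n a s hD hA hEf hRf hRc hv (Φ w) (hΦeq w) h hh)

end Torus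

/-! ## §3. Lattice `φ⁴`: the next-scale action is `C²` everywhere when `g ≥ 0`, `−m < min(2,a)` -/

/-- **THE `φ⁴_d` BACKGROUND MAP IS `C¹` AND ITS EFFECTIVE ACTION IS `C²` ON THE WHOLE COARSE CARRIER** (`u t = g t³ + m t`,
`0 ≤ g`, `−m < min(2,a)`; every side, period, dimension; ANY operators ∕ carrier maps with the displayed actions; `Φ` ANY map with
block means `w` and the `φ⁴` sitewise equation at every `w` — exists uniquely by (93)). [folklore] -/
theorem phiFour_effectiveAction_contDiff_two (n : ℕ) (a : ℝ) (s : ℕ) [NeZero s]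
    {Dop Aop : lp (fun _ : X d => ℝ) ∞ →L[ℝ] lp (fun _ : X d => ℝ) ∞}
    (hD : ∀ (f : lp (fun _ : X d => ℝ) ∞) (y : X d), Dop f y = (((n : ℝ) + 1) ^ d)⁻¹ * ∑ p ∈ B n y, f p)
    (hA : ∀ (f : lp (fun _ : X d => ℝ) ∞) (p : X d), Aop f p = ∑ r ∈ nbhd n p, AX n a p r * f r)
    {Ef : (Site d ((n + 1) * s) → ℝ) →L[ℝ] lp (fun _ : X d => ℝ) ∞}
    (hEf : ∀ (g : Site d ((n + 1) * s) → ℝ) (q : X d), Ef g q = g (siteOf d ((n + 1) * s) q))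
    {Rf : lp (fun _ : X d => ℝ) ∞ →L[ℝ] (Site d ((n + 1) * s) → ℝ)}
    (hRf : ∀ (h : lp (fun _ : X d => ℝ) ∞) (x : Site d ((n + 1) * s)), Rf h x = h (windowMap d ((n + 1) * s) x))
    {Rc : lp (fun _ : X d => ℝ) ∞ →L[ℝ] (Site d s → ℝ)}
    (hRc : ∀ (h : lp (fun _ : X d => ℝ) ∞) (x : Site d s), Rc h x = h (windowMap d s x))
    {g m : ℝ} (hg : 0 ≤ g) (hm : -m < min 2 a)
    (Φ : (Site d s → ℝ) → (Site d ((n + 1) * s) → ℝ))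
    (hΦQ : ∀ w : Site d s → ℝ, ((Rc.comp Dop).comp Ef) (Φ w) = w)
    (hΦeq : ∀ (w : Site d s → ℝ) (p : X d), Aop (Ef (Φ w)) p + (g * (Ef (Φ w) p) ^ 3 + m * Ef (Φ w) p)
      = (((n : ℝ) + 1) ^ d)⁻¹ * ∑ p' ∈ B n (blk n p), (Aop (Ef (Φ w)) p' + (g * (Ef (Φ w) p') ^ 3 + m * Ef (Φ w) p'))) :
    ContDiff ℝ 1 Φ ∧
      ContDiff ℝ 2 (fun w : Site d s → ℝ =>
        (1 / 2 : ℝ) * ∑ x, Φ w x * ((Rf.comp Aop).comp Ef) (Φ w) x + ∑ x, (g / 4 * (Φ w x) ^ 4 + m / 2 * (Φ w x) ^ 2)) := by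
  have hc : Continuous (fun t : ℝ => 3 * g * t ^ 2 + m) := by fun_prop
  exact ⟨torus_background_contDiff_one n a s hD hA (v := fun t => g / 4 * t ^ 4 + m / 2 * t ^ 2)
      (u := fun t => g * t ^ 3 + m * t) (u' := fun t => 3 * g * t ^ 2 + m) (hasDerivAt_phiFour_potential g m)
      (hasDerivAt_phiFour g m) hc (lam := -m) (fun t => by nlinarith [sq_nonneg t]) (by simpa using hm) hEf hRf hRc Φ hΦQ hΦeq,
    torus_effectiveAction_contDiff_two n a s hD hA (v := fun t => g / 4 * t ^ 4 + m / 2 * t ^ 2)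
      (u := fun t => g * t ^ 3 + m * t) (u' := fun t => 3 * g * t ^ 2 + m) (hasDerivAt_phiFour_potential g m)
      (hasDerivAt_phiFour g m) hc (lam := -m) (fun t => by nlinarith [sq_nonneg t]) (by simpa using hm) hEf hRf hRc Φ hΦQ hΦeq⟩

/-! ## §4. Toy -/

/-- Toy (§1 `contDiff_two_potential`): `v t = t²∕2`, `u = id`, `u′ ≡ 1` ⟹ `v ∈ C²`. -/
example : ContDiff ℝ 2 (fun t : ℝ => t ^ 2 / 2) :=
  contDiff_two_potential (u := fun t => t) (u' := fun _ => (1 : ℝ))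
    (fun t => by
      have h := (hasDerivAt_pow 2 t).div_const 2
      refine h.congr_deriv ?_
      push_cast
      ring)
    (fun t => hasDerivAt_id t) continuous_const

end Summit.QuantumFields.BalabanUV.T4Continuum.NE7b.SupTorusEffectiveActionSmooth

end
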